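import Mathlib.RingTheory.DedekindDomain.SInteger
import Mathlib.RingTheory.DedekindDomain.AdicValuation
import Mathlib.RingTheory.DedekindDomain.Factorization
import Mathlib.NumberTheory.NumberField.Basic
import Mathlib.RingTheory.Coprime.Lemmas
import HarnessLib

/-!
# X3, the DEGENERATE rows, class-level count: the `S`-INTEGERS at the primes of `m₀` — clearing
# denominators, `𝓞_K ↠ R/9R` when `3 ∤ m₀`, and cube roots of `S`-units are `S`-units
# (cell `bsd-eis`, seat `bsd-eis-x3` gen 9; bricks U1″/U6 of x3-MEMO-11; route K1 `AdditiveBranchIMC`,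
# crux `GordTwoRankZeroOffCaseOne` — supports only)

HONEST FRAMING (`run/shared/lean/pub/bsd-eis/README.md` §4): THEOREMS ONLY (no `def`, no named fact,
no `sorry`); nothing is booked; no label, tier or count of record moves.

## What (`K` a number field, `m₀ ∈ ℕ`, `S = {v : m₀ ∈ v}` the primes of `𝓞_K` dividing `m₀`, `R = S`-integers)
* `KummerFamily.exists_pow_mul_mem_range` — every `x ∈ R` has `m₀^k · x ∈ 𝓞_K` for some `k`
  (valuations at the finitely many `v ∣ m₀`).
* `KummerFamily.surjective_ringOfIntegers_quot_nine` — if `3 ∤ m₀`, `𝓞_K → R/9R` is onto: with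
  `α m₀ ≡ 1 (mod 9)`, `x ≡ (α m₀)^k x ∈ 𝓞_K (mod 9R)`. This is the hypothesis `hsurj` of
  `KummerFamily.natCard_units_quot_cubes_le` (`X3BranchCubesModNine.lean`).
* `KummerFamily.valuation_eq_one_of_pow` — `v(y³) = 1 ⟹ v(y) = 1`: a cube root in `K` of an
  `S`-unit is an `S`-unit (the independence input of the class-level count).
References: [NeukirchANT1999] Ch. I (11.6), Ch. II (3.8)–(3.9).
-/

set_option autoImplicit false

noncomputable section

open scoped Classical NumberField

namespace Summit.BirchSwinnertonDyer.Rank1Residual.Additive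

namespace KummerFamily

open NumberField IsDedekindDomain WithZero

variable {K : Type*} [Field K] [NumberField K]

/-! ### §1 Valuation bookkeeping in `ℤᵐ⁰` -/

omit [NumberField K] in
/-- **`v(y³) = 1 ⟹ v(y) = 1`** (and likewise for any positive power) in `ℤᵐ⁰`. [folklore] -/
theorem valuation_eq_one_of_pow (w : Valuation K ℤᵐ⁰) {y : K} {n : ℕ} (hn : n ≠ 0)
    (h : w (y ^ n) = 1) : w y = 1 := by
  rw [Valuation.map_pow] at h
  by_cases h0 : w y = 0
  · rw [h0, zero_pow hn] at h; exact absurd h zero_ne_one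
  · rw [← exp_log h0] at h ⊢
    rw [← exp_nsmul, ← exp_zero] at h
    have h' : n • log (w y) = 0 := exp_injective h
    rw [← exp_zero]
    congr 1
    rw [nsmul_eq_mul] at h'
    rcases mul_eq_zero.mp h' with h1 | h1
    · exact absurd (by exact_mod_cast h1) hn
    · exact h1

/-! ### §2 Clearing denominators of `S`-integers -/

/-- **Every `S`-integer is `y / m₀^k` with `y ∈ 𝓞_K`**, `S` the primes dividing `m₀ ≠ 0`: at each of
the finitely many `v ∣ m₀`, `v(m₀) ≤ exp(−1)` beats `v(x) = exp(a)` for `k ≥ a`; elsewhere `x` is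
already integral. [cite: NeukirchANT1999, Ch. I (11.6)] -/
theorem exists_pow_mul_mem_range {m₀ : ℕ} (hm₀ : m₀ ≠ 0)
    (x : ({v : HeightOneSpectrum (𝓞 K) | (m₀ : 𝓞 K) ∈ v.asIdeal} : Set _).integer K) :
    ∃ (k : ℕ) (y : 𝓞 K), algebraMap (𝓞 K) K y = (m₀ : K) ^ k * (x : K) := by
  -- `S` is finite
  have hSfin : ({v : HeightOneSpectrum (𝓞 K) | (m₀ : 𝓞 K) ∈ v.asIdeal} : Set _).Finite := by
    have hI : Ideal.span {(m₀ : 𝓞 K)} ≠ 0 := by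
      rw [Ne, Ideal.zero_eq_bot, Ideal.span_singleton_eq_bot]; exact_mod_cast hm₀
    refine (Ideal.finite_factors hI).subset fun v hv ↦ ?_
    exact (Ideal.dvd_span_singleton).mpr hv
  -- per-prime exponents
  have hper : ∀ v : HeightOneSpectrum (𝓞 K), ∃ k : ℕ, ∀ k' ≥ k,
      v.valuation K ((m₀ : K) ^ k' * (x : K)) ≤ 1 := by
    intro v
    have hm1 : v.valuation K (m₀ : K) ≤ 1 := by
      have := v.valuation_le_one (K := K) (m₀ : 𝓞 K)
      simpa using this
    by_cases hv : v ∈ ({v : HeightOneSpectrum (𝓞 K) | (m₀ : 𝓞 K) ∈ v.asIdeal} : Set _)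
    · have hmlt : v.valuation K (m₀ : K) < 1 := by
        have := (v.valuation_lt_one_iff_mem (K := K) (m₀ : 𝓞 K)).mpr hv
        simpa using this
      -- `v(m₀) ≤ exp(−1)` (cf. the tree's `SevenDivision.le_exp_neg_one_of_lt_one`, inlined)
      have hmle : v.valuation K (m₀ : K) ≤ exp (-1) := by
        have h0 : v.valuation K (m₀ : K) ≠ 0 := by
          rw [Valuation.ne_zero_iff]; exact_mod_cast hm₀
        rw [← exp_log h0, exp_le_exp]
        have : log (v.valuation K (m₀ : K)) < 0 := by
          rw [← exp_lt_exp, exp_log h0, exp_zero]; exact hmlt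
        omega
      by_cases hx0 : v.valuation K (x : K) = 0
      · exact ⟨0, fun k' _ ↦ by rw [Valuation.map_mul, hx0, mul_zero]; exact zero_le⟩
      · refine ⟨(log (v.valuation K (x : K))).toNat, fun k' hk' ↦ ?_⟩
        rw [Valuation.map_mul, Valuation.map_pow, ← exp_log hx0]
        calc v.valuation K (m₀ : K) ^ k' * exp (log (v.valuation K (x : K)))
            ≤ exp (-1) ^ k' * exp (log (v.valuation K (x : K))) :=
              mul_le_mul' (pow_le_pow_left₀ zero_le hmle k') le_rfl
          _ = exp (-(k' : ℤ) + log (v.valuation K (x : K))) := by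
              rw [← exp_nsmul, ← exp_add]; congr 1; simp
          _ ≤ exp 0 := by
              rw [exp_le_exp]
              have : log (v.valuation K (x : K)) ≤ (k' : ℤ) :=
                (Int.self_le_toNat _).trans (by exact_mod_cast hk')
              omega
          _ = 1 := exp_zero
    · exact ⟨0, fun k' _ ↦ by
        rw [Valuation.map_mul, Valuation.map_pow]
        exact mul_le_one' (pow_le_one' hm1 _) (x.2 v hv)⟩
  choose kv hkv using hper
  -- a uniform exponent over the finite set `S`
  set k : ℕ := hSfin.toFinset.sup kv with hk
  have hall : ∀ v : HeightOneSpectrum (𝓞 K), v.valuation K ((m₀ : K) ^ k * (x : K)) ≤ 1 := by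
    intro v
    by_cases hv : v ∈ ({v : HeightOneSpectrum (𝓞 K) | (m₀ : 𝓞 K) ∈ v.asIdeal} : Set _)
    · exact hkv v k (Finset.le_sup (hSfin.mem_toFinset.mpr hv))
    · rw [Valuation.map_mul, Valuation.map_pow]
      have hm1 : v.valuation K (m₀ : K) ≤ 1 := by
        have := v.valuation_le_one (K := K) (m₀ : 𝓞 K)
        simpa using this
      exact mul_le_one' (pow_le_one' hm1 _) (x.2 v hv)
  obtain ⟨y, hy⟩ := HeightOneSpectrum.mem_integers_of_valuation_le_one K _ hall
  exact ⟨k, y, hy⟩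

/-! ### §3 `𝓞_K ↠ R/9R` when `3 ∤ m₀` -/

/-- **`𝓞_K → R/9R` is onto** for `R` the `S`-integers at the primes of `m₀`, `3 ∤ m₀`: with
`α m₀ + 9 β = 1` and `m₀^k x = y ∈ 𝓞_K`, `α^k y − x = ((α m₀)^k − 1) x ∈ 9R`.
[cite: NeukirchANT1999, Ch. I (11.6)] -/
theorem surjective_ringOfIntegers_quot_nine {m₀ : ℕ} (hm₀ : m₀ ≠ 0) (h3 : ¬ 3 ∣ m₀) :
    Function.Surjective
      ((Ideal.Quotient.mk (Ideal.span {(9 :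
          ({v : HeightOneSpectrum (𝓞 K) | (m₀ : 𝓞 K) ∈ v.asIdeal} : Set _).integer K)})).comp
        (algebraMap (𝓞 K) (({v : HeightOneSpectrum (𝓞 K) | (m₀ : 𝓞 K) ∈ v.asIdeal} : Set _).integer K))) := by
  set R := ({v : HeightOneSpectrum (𝓞 K) | (m₀ : 𝓞 K) ∈ v.asIdeal} : Set _).integer K with hR
  intro q
  obtain ⟨x, rfl⟩ := Ideal.Quotient.mk_surjective q
  obtain ⟨k, y, hy⟩ := exists_pow_mul_mem_range (K := K) hm₀ x
  -- Bezout: `α m₀ + β 9 = 1`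
  have hcop : IsCoprime (m₀ : ℤ) 9 := by
    rw [Int.isCoprime_iff_gcd_eq_one]
    have : Nat.Coprime m₀ 9 := by
      rw [show (9 : ℕ) = 3 ^ 2 by norm_num]
      exact (Nat.Coprime.pow_right 2 ((Nat.Prime.coprime_iff_not_dvd Nat.prime_three).mpr h3).symm)
    exact_mod_cast this
  obtain ⟨α, β, hαβ⟩ := hcop
  refine ⟨α ^ k • y, ?_⟩
  rw [RingHom.comp_apply, Ideal.Quotient.eq, Ideal.mem_span_singleton']
  -- `(α m₀)^k − 1 = 9 t`
  have hdiv : (9 : ℤ) ∣ (α * m₀) ^ k - 1 := by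
    have h1 : (9 : ℤ) ∣ α * (m₀ : ℤ) - 1 := ⟨-β, by linear_combination hαβ⟩
    exact h1.trans (by simpa using sub_dvd_pow_sub_pow (α * (m₀ : ℤ)) 1 k)
  obtain ⟨t, ht⟩ := hdiv
  refine ⟨((t : ℤ) : R) * x, ?_⟩
  apply Subtype.ext
  have e1 : ((algebraMap (𝓞 K) R (α ^ k • y) : R) : K) = (α : K) ^ k * ((m₀ : K) ^ k * (x : K)) := by
    rw [show ((algebraMap (𝓞 K) R (α ^ k • y) : R) : K) = algebraMap (𝓞 K) K (α ^ k • y) from rfl,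
      map_zsmul, zsmul_eq_mul, Int.cast_pow, hy]
  have htK : ((α : K) * (m₀ : K)) ^ k - 1 = 9 * (t : K) := by exact_mod_cast ht
  have e9 : ((9 : R) : K) = 9 := by norm_cast
  have et : (((t : ℤ) : R) : K) = (t : K) := by norm_cast
  rw [Subalgebra.coe_sub, Subalgebra.coe_mul, Subalgebra.coe_mul, e1, e9, et]
  linear_combination (-(x : K)) * htK

end KummerFamily

end Summit.BirchSwinnertonDyer.Rank1Residual.Additive

end
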